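import Summits.Ventures.MM22.Rank333.Wang333LPOs
import Summits.Ventures.MM22.Rank333.Wang333LPAssembly
import HarnessLib

/-!
# MM22 venture, Route D3-STRETCH — `⟨3,3,3⟩/𝔽₂` LP certificate chain (dims 2–9): CHECKS 8

HONEST FRAMING (cell `pub-mm22`, seat p3, Route D3-STRETCH). Part of a kernel certificate chain for
`20 ≤ R_{𝔽₂}(⟨3,3,3⟩)` built from Wang's orbit table (arXiv:2603.07280, `cert_matrix_q02_n333`: 496 orbits of constraint
subspaces of the first factor under `GL₃ × GL₃ ⋊ C₂`) with NEW, much smaller justifications: p2's integer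
'fractional substitution' LP certificates (HOME/pub-mm22-p2/routeD/lpcert_333_int.json; the LP rule is LIT-2's
`Literature/…/SubstitutionLPBound.lean` + `SubstitutionLPBacktracking.lean`, the checker `GF2OrbitSweepLP.lean`) for 444 orbits
of dimensions 2–7, Wang's own flattenings (11) and forced products (14, two of them through the transpose twin) for the rest
of dimensions 5–9, explicit sandwich / transposed-sandwich lookups validated by the pull-back check (`GF2FastSandwich.lean`).
23 backtracking orbits of dimensions 2–5 are HYPOTHESES in this chain (their LP-DFS certificates are p2's gate G1, pending);
dimensions 0–1 are the already landed top layer (`WangTop333*.lean`). So the end theorem of this chain is CONDITIONAL on 23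
explicit orbit claims; nothing here asserts `RankGe20F2` unconditionally.

This file: per-orbit kernel checks `ok_i : orbitCheckX 3 3 osX i = true` — LP orbits via `ok_lp` (candidate cover, FAST
pull-back validation of both lookup tables, LP-leaf test), flattening / forced-product / transposed-lookup orbits by `decide`;
forced products also get their residual obligations `obl_i` by separating functionals.
-/

set_option Elab.async false
set_option maxRecDepth 100000

namespace Summit.Ventures.MM22.GF2Cert.LP333

open Summit.MatrixMultiplication.OmegaCensus.GF2RankLB Literature.Computability.AlgebraicComplexity
open Summit.Ventures.MM22.GF2Cert

/-- Orbit 425 (`K = [1, 10, 160]`, bound 17; LP certificate, 1 rows). -/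
theorem ok_425 : orbitCheckX 3 3 osX 425 = true := ok_lp osX 425 (by rw [show (osX.getD 425 default).steps = [st_425] from rfl, st_425]) (by decide +kernel) (by decide +kernel) (by decide +kernel) (by decide +kernel) (by decide +kernel)
/-- Orbit 426 (`K = [1, 10, 256]`, bound 17; LP certificate, 1 rows). -/
theorem ok_426 : orbitCheckX 3 3 osX 426 = true := ok_lp osX 426 (by rw [show (osX.getD 426 default).steps = [st_426] from rfl, st_426]) (by decide +kernel) (by decide +kernel) (by decide +kernel) (by decide +kernel) (by decide +kernel)
/-- Orbit 427 (`K = [1, 10, 258]`, bound 18; LP certificate, 24 rows). -/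
theorem ok_427 : orbitCheckX 3 3 osX 427 = true := ok_lp osX 427 (by rw [show (osX.getD 427 default).steps = [st_427] from rfl, st_427]) (by decide +kernel) (by decide +kernel) (by decide +kernel) (by decide +kernel) (by decide +kernel)
/-- Orbit 428 (`K = [1, 10, 272]`, bound 18; LP certificate, 40 rows). -/
theorem ok_428 : orbitCheckX 3 3 osX 428 = true := ok_lp osX 428 (by rw [show (osX.getD 428 default).steps = [st_428] from rfl, st_428]) (by decide +kernel) (by decide +kernel) (by decide +kernel) (by decide +kernel) (by decide +kernel)
end Summit.Ventures.MM22.GF2Cert.LP333
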